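import Mathlib
import Literature.NumberTheory.LFunctions.Zhang2022.Section8Eq81bEdge
import HarnessLib

/-!
# Zhang (2022) §8, (8.1) second equality (`Z22:(8.1)`b) from Lemma 5.9 ON ITS USE-RANGE and
# Proposition 2.2 (i) — the inputs the WINDOWED Proposition 2.2 supplies

Topic `Literature/NumberTheory/LFunctions/Zhang2022` (Landau–Siegel audit tree; verdict-neutral;
D-0069 campaign node **Z22:(8.1)** second equality, locator [Z22 p.42, tex L2203–2205]; typed claim
`Section8aStatements.Eq81b c′`; leaf `Eq81b` of `theorem1_of_leaves_v12`, input of the cone leaf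
`hD81 : Skeleton.Ded81V c′` of `theorem1_of_leaves_v11`).
Y. Zhang, *Discrete mean estimates and the Landau–Siegel zero*, arXiv:2211.02515v1 (2022)
[Zhang2022LandauSiegel] — **an unrefereed manuscript under adjudication**.

> "By Lemma 5.9, the residue theorem and a simple bound for `ω(s)`,
> `(1/2πi)∫_ℜ 𝒞̃(s,ψ)A(𝐚₁;s,ψ)A(𝐚₂,1−s,ψ̄)ω(s) ds = Ĩ₁⁺(𝐚₁,𝐚₂;ψ) − Ĩ₁⁻(𝐚₁,𝐚₂;ψ) + O(ε)`."

L2-t1's kernel edge `Section8aStatements.eq81b_of_prop22 : 0 ≤ c′ → Skeleton.Prop22 c′ → Eq81b c′`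
(`Section8Eq81bEdge`) uses Proposition 2.2 in exactly two ways: (i) "the zeros in `Ω` are on the
line" (clearance `|s − ρ| ≥ α` and `M(s,ψ) ≠ 0` on `σ = ½ ± α`), and Lemma 5.9 on the height range
`|t − 2πt₀| ≤ 𝓛₁ + 1/4` (`Skeleton.lemma59_restricted_of_prop22`). This file re-runs that proof
VERBATIM with those two inputs as hypotheses —
`Section8aStatements.eq81b_of_lemma59R : (Lemma 5.9 on 𝓛₁ + 1/4) → Prop22i → Eq81b c′` — so that
(8.1)b is also available from the WINDOWED node of record `Skeleton.Prop22W c′` via sz-d02's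
`Skeleton.lemma59_restricted_of_prop22W` (`Section5Lemma59Window`); the one-line corollary
`eq81b_of_prop22W` is in `Section8Ded81VClosed`. The private bookkeeping lemmas of
`Section8Eq81bEdge` (parameters, `t`-range, threshold, prefactors, the piece estimates, the final
arithmetic) are private there and are therefore repeated here verbatim; the public ingredients
(`norm_integrandTilde_le`, `clearance_of_prop22i`, `continuousOn_integrandTilde_vertical`,
`rectIntegral_sub_segInt_eq`) are imported. No new definition, no named fact. Adapted from
`Section8Eq81bEdge.lean` (L2-t1) with attribution.

WHAT THIS IS NOT: any claim about Proposition 2.2, Lemma 8.1's truth, Theorems 1–2 of the source,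
or Landau–Siegel zeros; Proposition 2.2 (i) and Lemma 5.9 stay hypotheses here.

## References

* Y. Zhang, arXiv:2211.02515v1 (2022), §8 (8.1) p. 42, tex L2197–2210; §2 (2.13), (2.15); §5 Lemmas
  5.2, 5.9; §7 (7.2). [cite: Zhang2022LandauSiegel, §8 (8.1) p.42]
-/

noncomputable section

open Complex Real MeasureTheory Set intervalIntegral

namespace Literature.NumberTheory.LFunctions.Zhang2022.Section8aStatements

open Skeleton

/-! ### A. The parameters for large `D` (verbatim from `Section8Eq81bEdge`, private there) -/


/-- Sizes of `α`, `Cα` and the shifts `b_j` once `𝓛 ≥ 80`, `𝓛 ≥ 5π|c′| + 1`, `𝓛 ≥ 4π|C| + 1`.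
[cite: Zhang2022LandauSiegel, §2 (2.10), (2.13)] -/
private theorem params81 {c' C : ℝ} {D : ℕ} (h80 : 80 ≤ ell D) (hc : 5 * π * |c'| + 1 ≤ ell D)
    (hC : 4 * π * |C| + 1 ≤ ell D) :
    0 < alpha D ∧ alpha D = π / ell D ^ 9 ∧ alpha D ≤ 1 / 100 ∧ |C| * alpha D ≤ 1 / 4 ∧
      |b1 c' D| ≤ 4 * alpha D ∧ |b2 c' D| ≤ 4 * alpha D ∧ |b3 c' D| ≤ 4 * alpha D := by
  have hπ := Real.pi_pos
  have hL0 : 0 < ell D := by linarith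
  have hL1 : 1 ≤ ell D := by linarith
  have hα : alpha D = π / ell D ^ 9 := by rw [alpha, bigP, Real.log_exp]
  have hL9 : ell D ≤ ell D ^ 9 := by
    calc ell D = ell D ^ 1 := (pow_one _).symm
      _ ≤ ell D ^ 9 := pow_le_pow_right₀ hL1 (by norm_num)
  have hL8 : ell D ≤ ell D ^ 8 := by
    calc ell D = ell D ^ 1 := (pow_one _).symm
      _ ≤ ell D ^ 8 := pow_le_pow_right₀ hL1 (by norm_num)
  have hL9pos : 0 < ell D ^ 9 := by positivity
  have hL8pos : 0 < ell D ^ 8 := by positivity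
  have hα0 : 0 < alpha D := by rw [hα]; positivity
  have hαL : alpha D ≤ π / ell D := by
    rw [hα]; exact div_le_div_of_nonneg_left hπ.le hL0 hL9
  have hα100 : alpha D ≤ 1 / 100 := by
    have hL2 : ell D ^ 2 ≤ ell D ^ 9 := pow_le_pow_right₀ hL1 (by norm_num)
    rw [hα, div_le_iff₀ hL9pos]; nlinarith [Real.pi_lt_four]
  have hCα : |C| * alpha D ≤ 1 / 4 := by
    have h1 : |C| * alpha D ≤ |C| * (π / ell D) := mul_le_mul_of_nonneg_left hαL (abs_nonneg C)
    have h2 : |C| * (π / ell D) ≤ 1 / 4 := by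
      rw [← mul_div_assoc, div_le_iff₀ hL0]; nlinarith [abs_nonneg C]
    exact h1.trans h2
  -- `|c′| α 𝓛 ≤ 1/5`
  have hαℓ : alpha D * ell D = π / ell D ^ 8 := by
    rw [hα]; field_simp
  have hcαL : |c'| * (alpha D * ell D) ≤ 1 / 5 := by
    rw [hαℓ]
    have h1 : |c'| * (π / ell D ^ 8) ≤ |c'| * (π / ell D) :=
      mul_le_mul_of_nonneg_left (div_le_div_of_nonneg_left hπ.le hL0 hL8) (abs_nonneg c')
    have h2 : |c'| * (π / ell D) ≤ 1 / 5 := by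
      rw [← mul_div_assoc, div_le_iff₀ hL0]; nlinarith [abs_nonneg c']
    exact h1.trans h2
  have habs : |c' * alpha D * ell D| ≤ 1 / 5 := by
    rw [mul_assoc, abs_mul, abs_of_nonneg (by positivity : 0 ≤ alpha D * ell D)]; exact hcαL
  obtain ⟨hm1, hm2⟩ := abs_le.mp habs
  refine ⟨hα0, hα, hα100, hCα, ?_, ?_, ?_⟩
  · rw [b1, abs_mul, abs_of_pos hα0]
    have : |1 - 5 * c' * alpha D * ell D| ≤ 4 := by
      rw [abs_le]; constructor <;> nlinarith
    nlinarith
  · rw [b2, abs_mul, abs_mul, abs_of_pos hα0, abs_two]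
    have : |1 + c' * alpha D * ell D| ≤ 2 := by
      rw [abs_le]; constructor <;> nlinarith
    nlinarith
  · rw [b3, abs_mul, abs_mul, abs_of_pos hα0, abs_of_pos (by norm_num : (0:ℝ) < 3)]
    have : |1 - c' * alpha D * ell D| ≤ 4 / 3 := by
      rw [abs_le]; constructor <;> nlinarith
    nlinarith

/-- The `t`-range of the contour pieces: `|t − 2π𝓛⁵¹⁹| ≤ 𝓛⁴⁰⁵ + 1/4`, `𝓛 ≥ 80` gives
`5𝓛⁵¹⁹ ≤ t ≤ 8𝓛⁵¹⁹`, `t ≥ 200`. [cite: Zhang2022LandauSiegel, §2 (2.8)] -/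
private theorem trange81 {L t : ℝ} (hL : 80 ≤ L) (ht : |t - 2 * π * L ^ 519| ≤ L ^ 405 + 1 / 4) :
    5 * L ^ 519 ≤ t ∧ t ≤ 8 * L ^ 519 ∧ 200 ≤ t := by
  have hL1 : 1 ≤ L := by linarith
  have h114 : 9 ≤ L ^ 114 := by
    have h : L ^ 1 ≤ L ^ 114 := pow_le_pow_right₀ hL1 (by norm_num)
    rw [pow_one] at h; linarith
  have h405 : L ^ 405 + 1 / 4 ≤ L ^ 519 := by
    have h1 : (1 : ℝ) ≤ L ^ 405 := one_le_pow₀ hL1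
    calc L ^ 405 + 1 / 4 ≤ L ^ 405 * 9 := by nlinarith
      _ ≤ L ^ 405 * L ^ 114 := by gcongr
      _ = L ^ 519 := by rw [← pow_add]
  have h519 : L ≤ L ^ 519 := by
    calc L = L ^ 1 := (pow_one _).symm
      _ ≤ L ^ 519 := pow_le_pow_right₀ hL1 (by norm_num)
  obtain ⟨ht1, ht2⟩ := abs_le.mp ht
  have hπa : 3 * L ^ 519 ≤ π * L ^ 519 :=
    mul_le_mul_of_nonneg_right Real.pi_gt_three.le (by positivity)
  have hπb : π * L ^ 519 ≤ 3.15 * L ^ 519 :=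
    mul_le_mul_of_nonneg_right Real.pi_lt_d2.le (by positivity)
  exact ⟨by linarith, by linarith, by linarith⟩

/-- The threshold `D ≥ ⌈e^{L₀}⌉` gives `L₀ ≤ 𝓛`. [folklore] -/
private theorem eq81b_threshold_le_ell {L₀ : ℝ} {D : ℕ} (hD : ⌈Real.exp L₀⌉₊ ≤ D) : L₀ ≤ ell D := by
  have h1 : Real.exp L₀ ≤ D := (Nat.le_ceil _).trans (by exact_mod_cast hD)
  have hD0 : (0 : ℝ) < D := (Real.exp_pos _).trans_le h1
  rw [ell, Real.le_log_iff_exp_le hD0]; exact h1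


/-! ### B. The piece estimates and the final arithmetic (verbatim from `Section8Eq81bEdge`) -/

/-- `‖1/(2πi)‖ ≤ 1/6` and `‖1/2π‖ ≤ 1/6`. [folklore] -/
private theorem norm_prefactors_le :
    ‖(1 / (2 * π * I) : ℂ)‖ ≤ 1 / 6 ∧ ‖(1 / (2 * π) : ℂ)‖ ≤ 1 / 6 := by
  have hπ := Real.pi_gt_three
  have h1 : ‖(1 / (2 * π) : ℂ)‖ = 1 / (2 * π) := by
    rw [show (1 / (2 * π) : ℂ) = ((1 / (2 * π) : ℝ) : ℂ) by push_cast; ring, Complex.norm_real,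
      Real.norm_of_nonneg (by positivity)]
  have h2 : ‖(1 / (2 * π * I) : ℂ)‖ = 1 / (2 * π) := by
    rw [norm_div, norm_mul, Complex.norm_I, mul_one, norm_one,
      show (2 * π : ℂ) = ((2 * π : ℝ) : ℂ) by push_cast; ring, Complex.norm_real,
      Real.norm_of_nonneg (by positivity)]
  have h3 : 1 / (2 * π) ≤ (1 : ℝ) / 6 := by
    rw [div_le_div_iff₀ (by positivity) (by norm_num)]; linarith
  exact ⟨h2 ▸ h3, h1 ▸ h3⟩

/-- A horizontal edge of `∂ℜ` at height `2πt₀ + L′`, `𝓛₁ − 1 ≤ |L′| ≤ 𝓛₁ + ¼`, contributes at most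
`M·2α` once the integrand is `≤ M` on the pieces (abstract bookkeeping; `P` = the clearance).
[cite: Zhang2022LandauSiegel, §8 (8.1) p.42] -/
private theorem norm_integral_horizontal_81b {F : ℂ → ℂ} {P : ℂ → Prop} {M α T L' ℓ : ℝ}
    (hα : 0 ≤ α)
    (hMs : ∀ s : ℂ, |s.re - 1 / 2| ≤ α → ℓ - 1 ≤ |s.im - T| → |s.im - T| ≤ ℓ + 1 / 4 → P s →
      ‖F s‖ ≤ M)
    (hL'1 : |L'| ≤ ℓ + 1 / 4) (hL'2 : ℓ - 1 ≤ |L'|)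
    (hP : ∀ s : ℂ, |s.re - 1 / 2| ≤ α → s.im = T + L' → P s) :
    ‖∫ u in (1 / 2 - α)..(1 / 2 + α), F (u + ((T + L' : ℝ) : ℂ) * I)‖ ≤
      M * |1 / 2 + α - (1 / 2 - α)| := by
  refine intervalIntegral.norm_integral_le_of_norm_le_const fun u hu => ?_
  rw [Set.uIoc_of_le (by linarith : 1 / 2 - α ≤ 1 / 2 + α)] at hu
  have hre : ((u : ℂ) + ((T + L' : ℝ) : ℂ) * I).re = u := by simp
  have him : ((u : ℂ) + ((T + L' : ℝ) : ℂ) * I).im = T + L' := by simp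
  have hσ : |((u : ℂ) + ((T + L' : ℝ) : ℂ) * I).re - 1 / 2| ≤ α := by
    rw [hre, abs_le]; constructor <;> linarith [hu.1, hu.2]
  exact hMs _ hσ (by rw [him, add_sub_cancel_left]; exact hL'2)
    (by rw [him, add_sub_cancel_left]; exact hL'1) (hP _ hσ him)

/-- A vertical sliver on `σ` (`|σ − ½| = α`) between heights `u`, `v` on the same side of `T = 2πt₀`
with `𝓛₁ − ¼ ≤ |u − T|, |v − T| ≤ 𝓛₁ + ¼` contributes at most `M·|v − u|` (abstract bookkeeping).
[cite: Zhang2022LandauSiegel, §8 (8.1) p.42] -/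
private theorem norm_integral_vertical_81b {F : ℂ → ℂ} {P : ℂ → Prop} {M α T ℓ σ u v : ℝ}
    (hMs : ∀ s : ℂ, |s.re - 1 / 2| ≤ α → ℓ - 1 ≤ |s.im - T| → |s.im - T| ≤ ℓ + 1 / 4 → P s →
      ‖F s‖ ≤ M)
    (hσ : |σ - 1 / 2| = α)
    (hu1 : ℓ - 1 / 4 ≤ |u - T|) (hu2 : |u - T| ≤ ℓ + 1 / 4)
    (hv1 : ℓ - 1 / 4 ≤ |v - T|) (hv2 : |v - T| ≤ ℓ + 1 / 4)
    (hside : (0 ≤ u - T ∧ 0 ≤ v - T) ∨ (u - T ≤ 0 ∧ v - T ≤ 0))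
    (hP : ∀ s : ℂ, |s.re - 1 / 2| = α → |s.im - T| ≤ ℓ + 1 → P s) :
    ‖∫ y in u..v, F ((σ : ℂ) + y * I)‖ ≤ M * |v - u| := by
  refine intervalIntegral.norm_integral_le_of_norm_le_const fun y hy => ?_
  have hre : ((σ : ℂ) + y * I).re = σ := by simp
  have him : ((σ : ℂ) + y * I).im = y := by simp
  have hy' : ℓ - 1 / 4 ≤ |y - T| ∧ |y - T| ≤ ℓ + 1 / 4 := by
    rw [Set.mem_uIoc] at hy
    rcases hside with ⟨hu0, hv0⟩ | ⟨hu0, hv0⟩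
    · rw [abs_of_nonneg hu0] at hu1 hu2
      rw [abs_of_nonneg hv0] at hv1 hv2
      rcases hy with ⟨hy1, hy2⟩ | ⟨hy1, hy2⟩
      · rw [abs_of_nonneg (by linarith)]; constructor <;> linarith
      · rw [abs_of_nonneg (by linarith)]; constructor <;> linarith
    · rw [abs_of_nonpos hu0] at hu1 hu2
      rw [abs_of_nonpos hv0] at hv1 hv2
      rcases hy with ⟨hy1, hy2⟩ | ⟨hy1, hy2⟩
      · rw [abs_of_nonpos (by linarith)]; constructor <;> linarith
      · rw [abs_of_nonpos (by linarith)]; constructor <;> linarith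
  exact hMs _ (by rw [hre, hσ]) (by rw [him]; linarith [hy'.1]) (by rw [him]; exact hy'.2)
    (hP _ (by rw [hre, hσ]) (by rw [him]; linarith [hy'.2]))

/-- The final arithmetic: six pieces of size `≤ M/4` each, weighted by `‖1/2πi‖, ‖1/2π‖ ≤ 1/6`,
total at most `M`. [folklore] -/
private theorem six_pieces_le {k m Hc Hd Pb Qb Pa Qa : ℂ} {M l₁ l₂ l₃ : ℝ} (hM : 0 ≤ M)
    (hk : ‖k‖ ≤ 1 / 6) (hm : ‖m‖ ≤ 1 / 6)
    (hHc : ‖Hc‖ ≤ M * l₁) (hHd : ‖Hd‖ ≤ M * l₁) (hPb : ‖Pb‖ ≤ M * l₂) (hQb : ‖Qb‖ ≤ M * l₃)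
    (hPa : ‖Pa‖ ≤ M * l₂) (hQa : ‖Qa‖ ≤ M * l₃)
    (hl₁ : l₁ ≤ 1 / 4) (hl₂ : l₂ ≤ 1 / 4) (hl₃ : l₃ ≤ 1 / 4) :
    ‖k * (Hc - Hd) + m * (Pb - Qb) - m * (Pa - Qa)‖ ≤ M := by
  have h1 : ‖k * (Hc - Hd)‖ ≤ 1 / 6 * (M / 4 + M / 4) := by
    rw [norm_mul]
    exact mul_le_mul hk ((norm_sub_le _ _).trans (add_le_add (by nlinarith) (by nlinarith)))
      (norm_nonneg _) (by norm_num)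
  have h2 : ‖m * (Pb - Qb)‖ ≤ 1 / 6 * (M / 4 + M / 4) := by
    rw [norm_mul]
    exact mul_le_mul hm ((norm_sub_le _ _).trans (add_le_add (by nlinarith) (by nlinarith)))
      (norm_nonneg _) (by norm_num)
  have h3 : ‖m * (Pa - Qa)‖ ≤ 1 / 6 * (M / 4 + M / 4) := by
    rw [norm_mul]
    exact mul_le_mul hm ((norm_sub_le _ _).trans (add_le_add (by nlinarith) (by nlinarith)))
      (norm_nonneg _) (by norm_num)
  calc ‖k * (Hc - Hd) + m * (Pb - Qb) - m * (Pa - Qa)‖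
      ≤ ‖k * (Hc - Hd) + m * (Pb - Qb)‖ + ‖m * (Pa - Qa)‖ := norm_sub_le _ _
    _ ≤ ‖k * (Hc - Hd)‖ + ‖m * (Pb - Qb)‖ + ‖m * (Pa - Qa)‖ :=
        add_le_add (norm_add_le _ _) le_rfl
    _ ≤ 1 / 6 * (M / 4 + M / 4) + 1 / 6 * (M / 4 + M / 4) + 1 / 6 * (M / 4 + M / 4) := by
        linarith
    _ ≤ M := by linarith


/-! ### C. The edge from Lemma 5.9 on its use-range and Proposition 2.2 (i) -/

set_option maxHeartbeats 400000 in
/-- **`Z22:(8.1)`, second equality, from Lemma 5.9 on `|t − 2πt₀| ≤ 𝓛₁ + 1/4` and Proposition 2.2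
(i)**: if Lemma 5.9 holds on that height range (every `c₀ > 0` gets its `C`) and the zeros of
`L(s,ψ)L(s,ψχ)` in `Ω` lie on the line (`Prop22i`), then `Eq81b c′` — "… and a simple bound for
`ω(s)`, `(1/2πi)∫_ℜ 𝒞̃AAω ds = Ĩ₁⁺ − Ĩ₁⁻ + O(ε)`", with `ε = e^{−𝓛¹⁰/8}` (`c = 1/8`). L2-t1's
`eq81b_of_prop22` verbatim with its two Prop-2.2 inputs as hypotheses (Lemma 5.2 = tree theorem
`Skeleton.lemma52_holds`). [cite: Zhang2022LandauSiegel, §8 (8.1) p.42, tex L2203–2205] -/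
theorem eq81b_of_lemma59R {c' : ℝ}
    (h59R : ∀ c₀ : ℝ, 0 < c₀ → ∃ C : ℝ, ForAllLarge fun D _ χ => ∀ x ∈ PsiOne χ, ∀ s : ℂ,
      |s.re - 1 / 2| ≤ alpha D → |s.im - 2 * π * t0 D| ≤ ell1 D + 1 / 4 →
        (∀ ρ : ℂ, x.ψ.LFunction ρ = 0 → c₀ * alpha D ≤ ‖s - ρ‖) →
          ‖x.ψ.LFunction (s + beta1 c' D) / x.ψ.LFunction s‖ ≤ C * Real.log (bigP D))
    (hP22i : Prop22i) : Eq81b c' := by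
  -- adapted from Section8Eq81bEdge.lean (L2-t1), `eq81b_of_prop22`
  intro B C c₀ hc₀
  obtain ⟨C₅₂, D₅₂, h52⟩ := lemma52_holds c'
  have hc₁ : 0 < min c₀ 1 := lt_min hc₀ one_pos
  obtain ⟨C₅₉, D₅₉, h59⟩ := h59R (min c₀ 1) hc₁
  obtain ⟨D₂₂, h22i⟩ := hP22i
  set K : ℝ := (|C₅₂| + 1) * Real.exp 14 * ((|C₅₉| + 1) *
    (16 * (∑' n : ℕ, ((n + 1 : ℕ) : ℝ) ^ (-(5 / 4 : ℝ))) ^ 2) * B ^ 2 *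
    (9 ^ 6 * 256 * Real.exp 2)) with hK
  set L₀ : ℝ := max 80 (max (5 * π * |c'| + 1) (4 * π * |C| + 1)) with hL₀
  refine ⟨1 / 8, by norm_num, K, max (max D₅₂ D₅₉) (max D₂₂ ⌈Real.exp L₀⌉₊), ?_⟩
  intro D _ χ hD hq hp _ a₁ a₂ ha₁ ha₂ x hx Lm Lp hR
  -- thresholds
  have hD52 : D₅₂ ≤ D := (le_max_left _ _).trans ((le_max_left _ _).trans hD)
  have hD59 : D₅₉ ≤ D := (le_max_right _ _).trans ((le_max_left _ _).trans hD)
  have hD22 : D₂₂ ≤ D := (le_max_left _ _).trans ((le_max_right _ _).trans hD)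
  have hDℓ : ⌈Real.exp L₀⌉₊ ≤ D := (le_max_right _ _).trans ((le_max_right _ _).trans hD)
  have hL : L₀ ≤ ell D := eq81b_threshold_le_ell hDℓ
  have h80 : 80 ≤ ell D := (le_max_left _ _).trans hL
  have hcL : 5 * π * |c'| + 1 ≤ ell D := ((le_max_left _ _).trans (le_max_right _ _)).trans hL
  have hCL : 4 * π * |C| + 1 ≤ ell D := ((le_max_right _ _).trans (le_max_right _ _)).trans hL
  obtain ⟨hα0, -, hα100, hCα, hb1, hb2, hb3⟩ := params81 h80 hcL hCL
  have hα4 : alpha D ≤ 1 / 4 := by linarith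
  have h4α : 4 * alpha D ≤ 1 := by linarith
  have hB : 0 ≤ B := (norm_nonneg _).trans (ha₁.1 0)
  have hK0 : 0 ≤ K := by rw [hK]; positivity
  have hℓ1 : (1 : ℝ) ≤ ell1 D := by rw [ell1]; exact one_le_pow₀ (by linarith)
  -- the admissible rectangle
  obtain ⟨hLp, hLm, -, hclear⟩ := hR
  have hCα' : C * alpha D ≤ 1 / 4 :=
    le_trans (mul_le_mul_of_nonneg_right (le_abs_self C) hα0.le) hCα
  obtain ⟨hLp1, hLp2⟩ := abs_le.mp (hLp.trans hCα')
  obtain ⟨hLm1, hLm2⟩ := abs_le.mp (hLm.trans hCα')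
  -- (1) the pointwise bound `M` on the pieces, with the clearance predicate `P`
  have hMs : ∀ s : ℂ, |s.re - 1 / 2| ≤ alpha D → ell1 D - 1 ≤ |s.im - 2 * π * t0 D| →
      |s.im - 2 * π * t0 D| ≤ ell1 D + 1 / 4 →
      (∀ ρ : ℂ, x.ψ.LFunction ρ = 0 → min c₀ 1 * alpha D ≤ ‖s - ρ‖) →
      ‖integrandTilde c' x a₁ a₂ s‖ ≤ K * Real.exp (-(ell D ^ 10 / 8)) := by
    intro s hσ ht1 ht2 hcl
    have h52s := h52 D χ hD52 hq hp x s ⟨hσ, by linarith⟩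
    have h59s := h59 D χ hD59 hq hp x hx s hσ ht2 hcl
    exact norm_integrandTilde_le c' x h80 hcL ha₁ ha₂ hσ ht1 ht2 h52s h59s
  -- (2) the clearance: on `∂ℜ` by admissibility, on `σ = ½ ± α` by Prop. 2.2 (i)
  have h22x : ∀ s ∈ prodZeroSetOmega χ x, s.re = 1 / 2 := h22i D χ hD22 hq hp x hx
  have hclV : ∀ s : ℂ, |s.re - 1 / 2| = alpha D → |s.im - 2 * π * t0 D| ≤ ell1 D + 1 →
      ∀ ρ : ℂ, x.ψ.LFunction ρ = 0 → min c₀ 1 * alpha D ≤ ‖s - ρ‖ := by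
    intro s hσ ht ρ hρ
    have h := clearance_of_prop22i h22x hα4 hσ ht ρ hρ
    exact le_trans (mul_le_of_le_one_left hα0.le (min_le_right _ _)) h
  have hclH : ∀ L' : ℝ, (L' = Lm ∨ L' = Lp) → ∀ s : ℂ, |s.re - 1 / 2| ≤ alpha D →
      s.im = 2 * π * t0 D + L' →
      ∀ ρ : ℂ, x.ψ.LFunction ρ = 0 → min c₀ 1 * alpha D ≤ ‖s - ρ‖ := by
    intro L' hL' s hs1 hs2 ρ hρ
    have hon : s ∈ onBoundaryR D Lm Lp := by
      refine ⟨⟨hs1, ?_, ?_⟩, ?_⟩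
      · rcases hL' with rfl | rfl <;> linarith
      · rcases hL' with rfl | rfl <;> linarith
      · intro hin
        rcases hL' with rfl | rfl
        · exact absurd hin.2.1 (by rw [hs2]; exact lt_irrefl _)
        · exact absurd hin.2.2 (by rw [hs2]; exact lt_irrefl _)
    exact le_trans (mul_le_mul_of_nonneg_right (min_le_left _ _) hα0.le) (hclear s hon ρ hρ)
  -- (3) continuity along `σ = ½ ± α` on `[T − 𝓛₁ − ¼, T + 𝓛₁ + ¼]` (no zero there, by (2))
  have hcontV : ∀ σ : ℝ, |σ - 1 / 2| = alpha D →
      ContinuousOn (fun y : ℝ => integrandTilde c' x a₁ a₂ ((σ : ℂ) + y * I))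
        (Icc (2 * π * t0 D - ell1 D - 1 / 4) (2 * π * t0 D + ell1 D + 1 / 4)) := by
    intro σ hσ
    refine continuousOn_integrandTilde_vertical c' x a₁ a₂ σ (hb1.trans h4α) (hb2.trans h4α)
      (hb3.trans h4α) (fun y hy => ?_) (fun y hy => ?_)
    · have hy' : |y - 2 * π * ell D ^ 519| ≤ ell D ^ 405 + 1 / 4 := by
        have e1 : t0 D = ell D ^ 519 := rfl
        have e2 : ell1 D = ell D ^ 405 := rfl
        rw [← e1, ← e2, abs_le]; constructor <;> linarith [hy.1, hy.2]
      linarith [(trange81 h80 hy').2.2]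
    · intro h0
      have hy' : |((σ : ℂ) + y * I).im - 2 * π * t0 D| ≤ ell1 D + 1 := by
        have : ((σ : ℂ) + y * I).im = y := by simp
        rw [this, abs_le]; constructor <;> linarith [hy.1, hy.2]
      have h := hclV ((σ : ℂ) + y * I) (by simpa using hσ) hy' _ h0
      rw [sub_self, norm_zero] at h
      linarith [mul_pos hc₁ hα0]
  have hσb : |1 / 2 + alpha D - 1 / 2| = alpha D := by rw [add_sub_cancel_left, abs_of_pos hα0]
  have hσa : |1 / 2 - alpha D - 1 / 2| = alpha D := by
    rw [sub_sub_cancel_left, abs_neg, abs_of_pos hα0]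
  -- (4) the contour identity
  have hE := rectIntegral_sub_segInt_eq (integrandTilde c' x a₁ a₂) Lm Lp _ _
    (hcontV _ hσb) (hcontV _ hσa) (by constructor <;> linarith) (by constructor <;> linarith)
    (by constructor <;> linarith) (by constructor <;> linarith)
  simp only [Itil]
  rw [hE]
  -- (5) the six pieces
  have hT1 : ∀ u : ℝ, 2 * π * t0 D + u - 2 * π * t0 D = u := fun u => by ring
  have hT2 : 2 * π * t0 D - ell1 D - 2 * π * t0 D = -ell1 D := by ring
  have hLmA : |Lm| ≤ ell1 D + 1 / 4 ∧ ell1 D - 1 / 4 ≤ |Lm| := by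
    rw [abs_of_nonpos (by linarith)]; constructor <;> linarith
  have hLpA : |Lp| ≤ ell1 D + 1 / 4 ∧ ell1 D - 1 / 4 ≤ |Lp| := by
    rw [abs_of_nonneg (by linarith)]; constructor <;> linarith
  have hℓA : |ell1 D| = ell1 D := abs_of_nonneg (by linarith)
  have hℓA' : |(-ell1 D)| = ell1 D := by rw [abs_neg, hℓA]
  have hq1 : ell1 D - 1 / 4 ≤ ell1 D := by linarith
  have hq2 : ell1 D ≤ ell1 D + 1 / 4 := by linarith
  have hHc := norm_integral_horizontal_81b (L' := Lm) hα0.le hMs hLmA.1 (by linarith [hLmA.2])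
    (hclH Lm (Or.inl rfl))
  have hHd := norm_integral_horizontal_81b (L' := Lp) hα0.le hMs hLpA.1 (by linarith [hLpA.2])
    (hclH Lp (Or.inr rfl))
  have hPb := norm_integral_vertical_81b (u := 2 * π * t0 D + Lm) (v := 2 * π * t0 D - ell1 D)
    hMs hσb (by rw [hT1]; exact hLmA.2) (by rw [hT1]; exact hLmA.1) (by rw [hT2, hℓA']; exact hq1)
    (by rw [hT2, hℓA']; exact hq2) (Or.inr ⟨by rw [hT1]; linarith, by rw [hT2]; linarith⟩) hclV
  have hQb := norm_integral_vertical_81b (u := 2 * π * t0 D + Lp) (v := 2 * π * t0 D + ell1 D)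
    hMs hσb (by rw [hT1]; exact hLpA.2) (by rw [hT1]; exact hLpA.1) (by rw [hT1, hℓA]; exact hq1)
    (by rw [hT1, hℓA]; exact hq2) (Or.inl ⟨by rw [hT1]; linarith, by rw [hT1]; linarith⟩) hclV
  have hPa := norm_integral_vertical_81b (u := 2 * π * t0 D + Lm) (v := 2 * π * t0 D - ell1 D)
    hMs hσa (by rw [hT1]; exact hLmA.2) (by rw [hT1]; exact hLmA.1) (by rw [hT2, hℓA']; exact hq1)
    (by rw [hT2, hℓA']; exact hq2) (Or.inr ⟨by rw [hT1]; linarith, by rw [hT2]; linarith⟩) hclV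
  have hQa := norm_integral_vertical_81b (u := 2 * π * t0 D + Lp) (v := 2 * π * t0 D + ell1 D)
    hMs hσa (by rw [hT1]; exact hLpA.2) (by rw [hT1]; exact hLpA.1) (by rw [hT1, hℓA]; exact hq1)
    (by rw [hT1, hℓA]; exact hq2) (Or.inl ⟨by rw [hT1]; linarith, by rw [hT1]; linarith⟩) hclV
  -- lengths and prefactors
  have hlenH : |1 / 2 + alpha D - (1 / 2 - alpha D)| ≤ 1 / 4 := by
    rw [show 1 / 2 + alpha D - (1 / 2 - alpha D) = 2 * alpha D by ring, abs_of_pos (by positivity)]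
    linarith
  have hlen1 : |2 * π * t0 D - ell1 D - (2 * π * t0 D + Lm)| ≤ 1 / 4 := by
    rw [show 2 * π * t0 D - ell1 D - (2 * π * t0 D + Lm) = -(Lm + ell1 D) by ring, abs_neg]
    exact hLm.trans hCα'
  have hlen2 : |2 * π * t0 D + ell1 D - (2 * π * t0 D + Lp)| ≤ 1 / 4 := by
    rw [show 2 * π * t0 D + ell1 D - (2 * π * t0 D + Lp) = -(Lp - ell1 D) by ring, abs_neg]
    exact hLp.trans hCα'
  obtain ⟨hk, hm⟩ := norm_prefactors_le
  -- (6) assemble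
  have hfin : Real.exp (-(1 / 8) * ell D ^ 10) = Real.exp (-(ell D ^ 10 / 8)) := by
    congr 1; ring
  rw [hfin]
  exact six_pieces_le (mul_nonneg hK0 (Real.exp_pos _).le) hk hm hHc hHd hPb hQb hPa hQa hlenH
    hlen1 hlen2

end Literature.NumberTheory.LFunctions.Zhang2022.Section8aStatements
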